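import Summits.CriticalPhenomena.PercolationContinuityZ3.Theorems.SahiMasterFamilyFourStep
import Summits.CriticalPhenomena.PercolationContinuityZ3.Theorems.PercNearOneGluingNoHeavyLowerTailSahiMeetTowerAllOrders
import Literature.Combinatorics.Sahi2008.Multilinear

/-!
# Annihilated slots of `E_n` (every order) and the structural form of the order-four sandwich identity

Unit `prim-master-conj` (crux anchor stmt-CriticalPhenomena-4575); companion of `SahiMasterFamilyFourStep.lean`.
The order-four identity there was proved by `ring` on the fifteen-term form.  Its MECHANISM is order-free and is
recorded here for the higher-order steps (K4-NOTES §7–§8 of the unit): for ANY weight `μ` and ANY functions,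

* (the tree's `SahiMeetTowerAll.sahiE_cons_of_mul_eq_zero`, prim-l12-p5: if `h` annihilates every member of `F` then
  `E_{n+2}(h, F) = −E(h)·E_{n+1}(F)`;)
* `sahiE_cons_cons_of_mul_eq_zero`: if `h` annihilates every member of `F` (but maybe not `D`) then
  `E_{n+3}(h, D, F) = −E(h)·E_{n+2}(D, F) − E(h·D)·E_{n+1}(F)`
(both straight from the Lieb–Sahi recursion `sahiE_fin_cons` and `sahiE_update_zero`; extends `E_n(1,…,1) = 0`-type
branching to annihilators).  Consequence for increasing events (`sahiE_four_sandwich_split`): with the forced-open hull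
`K ⊇ G` of a `Z_3`-triple `(X, Y, G)` via `(X, Y)` and `N = K ∖ G` (which is disjoint from `X` and from `Y`),
`E_4(G, D, X, Y) = E_4(K, D, X, Y) + P(N)·E_3(D, X, Y)` — the frame `(X, Y, K)` being mutually independent, the first
term is the tree's independent-frame functional (`Literature.Combinatorics.Sahi2008.sahiE_eq_sum_cov_of_indepMoments`).
Everything here is proved; axioms standard. [this work]
-/

noncomputable section

open scoped Classical

namespace Summit.CriticalPhenomena.PercolationContinuityZ3.Theorems

open Finset Function
open Literature.Combinatorics.Sahi2008
open Literature.Probability.LatticeModels (prodBernoulli)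
open Literature.Probability.Percolation.DecisionTree (ind ind_of_mem ind_of_not_mem)

/-! ### Annihilated slots (abstract: any weight, any functions, every order) -/

section Abstract

variable {α : Type*} [Fintype α]

/-- **An annihilator of all members but one**: if `F_j · h = 0` for every `j` (no condition on `D`) then
`E_{n+3}(h, D, F) = −E(h)·E_{n+2}(D, F) − E(h·D)·E_{n+1}(F)`. [this work] -/
theorem sahiE_cons_cons_of_mul_eq_zero (μ : α → ℝ) (n : ℕ) (h D : α → ℝ) (F : Fin (n + 1) → α → ℝ)
    (hann : ∀ j, F j * h = 0) :
    sahiE μ (n + 3) (Fin.cons h (Fin.cons D F) : Fin (n + 3) → α → ℝ) =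
      -(sahiE μ (n + 2) (Fin.cons D F : Fin (n + 2) → α → ℝ) * ex μ h) - sahiE μ (n + 1) F * ex μ (D * h) := by
  rw [sahiE_fin_cons, Fin.sum_univ_succ]
  have e0 : update (Fin.cons D F : Fin (n + 2) → α → ℝ) 0 ((Fin.cons D F : Fin (n + 2) → α → ℝ) 0 * h) =
      (Fin.cons (D * h) F : Fin (n + 2) → α → ℝ) := by
    ext j x
    refine Fin.cases ?_ (fun k => ?_) j
    · simp only [update_self, Fin.cons_zero]
    · rw [update_of_ne (Fin.succ_ne_zero k), Fin.cons_succ, Fin.cons_succ]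
  have es : ∀ k : Fin (n + 1), sahiE μ (n + 2)
      (update (Fin.cons D F : Fin (n + 2) → α → ℝ) k.succ ((Fin.cons D F : Fin (n + 2) → α → ℝ) k.succ * h)) = 0 :=
    fun k => by rw [Fin.cons_succ, hann k]; exact sahiE_update_zero μ _ _
  have hDh : ∀ j, F j * (D * h) = 0 := fun j => by rw [mul_left_comm, hann j, mul_zero]
  rw [e0, SahiMeetTowerAll.sahiE_cons_of_mul_eq_zero μ n (D * h) F hDh]
  simp only [es, sum_const_zero, add_zero]
  ring

end Abstract

/-! ### The structural form of the order-four sandwich identity -/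

section Events

variable {ι : Type*} [Fintype ι]

omit [Fintype ι] in
/-- Indicators of disjoint events annihilate each other. [folklore] -/
theorem ind_mul_ind_eq_zero_of_disjoint {A B : Set (Set ι)} (h : Disjoint A B) : ind A * ind B = 0 := by
  funext ω
  simp only [Pi.mul_apply, Pi.zero_apply]
  by_cases hA : ω ∈ A
  · rw [ind_of_not_mem (Set.disjoint_left.1 h hA), mul_zero]
  · rw [ind_of_not_mem hA, zero_mul]

omit [Fintype ι] in
/-- The indicator of a difference `K ∖ G` with `G ⊆ K` is `1_K − 1_G`. [folklore] -/
theorem ind_diff_eq_sub {G K : Set (Set ι)} (h : G ⊆ K) : ind (K \ G) = ind K - ind G := by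
  funext ω
  simp only [Pi.sub_apply]
  by_cases hG : ω ∈ G
  · rw [ind_of_mem (h hG), ind_of_mem hG, ind_of_not_mem (fun hω => hω.2 hG), sub_self]
  · by_cases hK : ω ∈ K
    · rw [ind_of_mem (show ω ∈ K \ G from ⟨hK, hG⟩), ind_of_mem hK, ind_of_not_mem hG, sub_zero]
    · rw [ind_of_not_mem (fun hω => hK hω.1), ind_of_not_mem hK, ind_of_not_mem hG, sub_zero]

/-- **Structural form of the sandwich identity.**  For increasing `X, Y, G` with `ZVia X Y G`, `X, Y` nonempty, the
forced-open hull `K` and `N = K ∖ G`:  `E_4(G, D, X, Y) = E_4(K, D, X, Y) + P(N)·E_3(D, X, Y)` for every product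
measure and every event `D` — multilinearity in the `G`-slot plus the annihilator identity (`N` is disjoint from `X`
and from `Y`, and `E_2(X, Y) = 0`). [this work] -/
theorem sahiE_four_sandwich_split (p : ι → unitInterval) {X Y G : Set (Set ι)} (D : Set (Set ι)) (hX : IsUpperSet X)
    (hY : IsUpperSet Y) (hG : IsUpperSet G) (hXne : X.Nonempty) (hYne : Y.Nonempty) (hZ : ZVia X Y G)
    (K : Set (Set ι)) (hK : K = {ω : Set ι | ω ∪ ↑(esupp X ∪ esupp Y) ∈ G}) :
    sahiE (bernoulliWeight p) 4 ![ind G, ind D, ind X, ind Y] =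
      sahiE (bernoulliWeight p) 4 ![ind K, ind D, ind X, ind Y] +
        (prodBernoulli p).real (K \ G) * sahiE (bernoulliWeight p) 3 ![ind D, ind X, ind Y] := by
  have hGK : G ⊆ K := hK ▸ subset_forcedHull hG _
  have hXG : X ∩ G = X ∩ K := hK ▸ sandwich_left hX hY hG hYne hZ
  have hYG : Y ∩ G = Y ∩ K := hK ▸ sandwich_right hX hY hG hXne hZ
  -- `N = K \ G` is disjoint from `X` and from `Y`
  have dX : Disjoint X (K \ G) := Set.disjoint_left.2 fun ω hωX hωN =>
    hωN.2 ((Set.ext_iff.1 hXG ω).2 ⟨hωX, hωN.1⟩).2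
  have dY : Disjoint Y (K \ G) := Set.disjoint_left.2 fun ω hωY hωN =>
    hωN.2 ((Set.ext_iff.1 hYG ω).2 ⟨hωY, hωN.1⟩).2
  -- multilinearity in slot 0: `1_G = 1_K − 1_N`
  have hlin : ind G = (1 : ℝ) • ind K + (-1 : ℝ) • ind (K \ G) := by
    rw [ind_diff_eq_sub hGK, one_smul, neg_one_smul]; abel
  have hupd : ∀ f : Set ι → ℝ, (![f, ind D, ind X, ind Y] : Fin 4 → Set ι → ℝ) =
      update (![ind G, ind D, ind X, ind Y] : Fin 4 → Set ι → ℝ) 0 f := fun f => by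
    funext j; fin_cases j <;> rfl
  have key := sahiE_update_lin (bernoulliWeight p) 4 (![ind G, ind D, ind X, ind Y]) 0 1 (-1) (ind K) (ind (K \ G))
  rw [← hupd, ← hupd, ← hupd, ← hlin] at key
  -- the annihilator identity for `E_4(N, D, X, Y)`
  have hcons : (![ind (K \ G), ind D, ind X, ind Y] : Fin 4 → Set ι → ℝ) =
      (Fin.cons (ind (K \ G)) (Fin.cons (ind D) ![ind X, ind Y]) : Fin 4 → Set ι → ℝ) := by
    funext j; fin_cases j <;> rfl
  have hann : ∀ j : Fin 2, (![ind X, ind Y] : Fin 2 → Set ι → ℝ) j * ind (K \ G) = 0 := by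
    intro j; fin_cases j
    · exact ind_mul_ind_eq_zero_of_disjoint dX
    · exact ind_mul_ind_eq_zero_of_disjoint dY
  have h2 : sahiE (bernoulliWeight p) 2 ![ind X, ind Y] = 0 :=
    sahiE_ind_eq_zero_of_suppZeroFlag p (U := ![X, Y]) hZ.1
  have hcons3 : (Fin.cons (ind D) ![ind X, ind Y] : Fin 3 → Set ι → ℝ) = ![ind D, ind X, ind Y] := by
    funext j; fin_cases j <;> rfl
  have hN : sahiE (bernoulliWeight p) 4 ![ind (K \ G), ind D, ind X, ind Y] =
      -((prodBernoulli p).real (K \ G) * sahiE (bernoulliWeight p) 3 ![ind D, ind X, ind Y]) := by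
    rw [hcons, sahiE_cons_cons_of_mul_eq_zero _ 1 _ _ _ hann, h2, zero_mul, sub_zero, hcons3,
      ex_bernoulliWeight_ind]
    ring
  rw [key, hN]
  ring

end Events

/-! ### Two free slots (appended 2026-08-20, gen 4): the shape needed at order five -/

section TwoFree

variable {α : Type*} [Fintype α]

/-- **An annihilator of all members but two**: if `F_j · h = 0` for every `j` (no condition on `D₁`, `D₂`) then
`E_{n+4}(h, D₁, D₂, F) = −E(h)·E_{n+3}(D₁, D₂, F) − E(h·D₁)·E_{n+2}(D₂, F) − E(h·D₂)·E_{n+2}(D₁, F) − 2E(h·D₁·D₂)·E_{n+1}(F)`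
(the Lieb–Sahi recursion in the head slot: the two surviving summands are the one-free-slot case after moving the
merged slot to the front). [this work] -/
theorem sahiE_cons_cons_cons_of_mul_eq_zero (μ : α → ℝ) (n : ℕ) (h D₁ D₂ : α → ℝ) (F : Fin (n + 1) → α → ℝ)
    (hann : ∀ j, F j * h = 0) :
    sahiE μ (n + 4) (Fin.cons h (Fin.cons D₁ (Fin.cons D₂ F)) : Fin (n + 4) → α → ℝ) =
      -(sahiE μ (n + 3) (Fin.cons D₁ (Fin.cons D₂ F) : Fin (n + 3) → α → ℝ) * ex μ h)
        - sahiE μ (n + 2) (Fin.cons D₂ F : Fin (n + 2) → α → ℝ) * ex μ (D₁ * h)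
        - sahiE μ (n + 2) (Fin.cons D₁ F : Fin (n + 2) → α → ℝ) * ex μ (D₂ * h)
        - 2 * (sahiE μ (n + 1) F * ex μ (D₁ * D₂ * h)) := by
  have hD₁ : ∀ j, F j * (D₁ * h) = 0 := fun j => by rw [mul_left_comm, hann j, mul_zero]
  have hD₂ : ∀ j, F j * (D₂ * h) = 0 := fun j => by rw [mul_left_comm, hann j, mul_zero]
  have h12 : ∀ j, F j * (D₂ * h * D₁) = 0 := fun j => by rw [← mul_assoc, hD₂ j, zero_mul]
  -- the slot-`D₂` summand, computed by the recursion in the head slot `D₁` (no slot moving needed)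
  have hB : sahiE μ (n + 3) (Fin.cons D₁ (Fin.cons (D₂ * h) F) : Fin (n + 3) → α → ℝ) =
      -(sahiE μ (n + 1) F * ex μ (D₁ * D₂ * h))
        - sahiE μ (n + 2) (Fin.cons D₁ F : Fin (n + 2) → α → ℝ) * ex μ (D₂ * h) := by
    rw [sahiE_fin_cons, Fin.sum_univ_succ, Fin.update_cons_zero, Fin.cons_zero,
      SahiMeetTowerAll.sahiE_cons_of_mul_eq_zero μ n (D₂ * h * D₁) F h12,
      SahiMeetTowerAll.sahiE_cons_of_mul_eq_zero μ n (D₂ * h) F hD₂, sahiE_fin_cons μ n D₁ F]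
    have hk : ∀ k : Fin (n + 1), sahiE μ (n + 2)
        (update (Fin.cons (D₂ * h) F : Fin (n + 2) → α → ℝ) k.succ
          ((Fin.cons (D₂ * h) F : Fin (n + 2) → α → ℝ) k.succ * D₁)) =
        -(sahiE μ (n + 1) (update F k (F k * D₁)) * ex μ (D₂ * h)) := fun k => by
      rw [Fin.cons_succ, ← Fin.cons_update]
      refine SahiMeetTowerAll.sahiE_cons_of_mul_eq_zero μ n (D₂ * h) _ fun j => ?_
      by_cases hj : j = k
      · subst hj
        rw [update_self, mul_right_comm, hD₂ j, zero_mul]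
      · rw [update_of_ne hj, hD₂ j]
    simp only [hk, sum_neg_distrib, ← sum_mul]
    have hm : D₂ * h * D₁ = D₁ * D₂ * h := by rw [mul_comm, ← mul_assoc]
    rw [hm]
    ring
  have hz : ∀ k : Fin (n + 1), sahiE μ (n + 3)
      (update (Fin.cons D₁ (Fin.cons D₂ F) : Fin (n + 3) → α → ℝ) k.succ.succ
        ((Fin.cons D₁ (Fin.cons D₂ F) : Fin (n + 3) → α → ℝ) k.succ.succ * h)) = 0 := fun k => by
    rw [Fin.cons_succ, Fin.cons_succ, hann k]; exact sahiE_update_zero μ _ _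
  rw [sahiE_fin_cons, Fin.sum_univ_succ, Fin.sum_univ_succ, Fin.update_cons_zero, Fin.cons_zero,
    Fin.cons_succ, Fin.cons_zero, ← Fin.cons_update, Fin.update_cons_zero,
    sahiE_cons_cons_of_mul_eq_zero μ n (D₁ * h) D₂ F hD₁, hB]
  simp only [hz, sum_const_zero, add_zero]
  have hm' : D₂ * (D₁ * h) = D₁ * D₂ * h := by rw [mul_left_comm, mul_assoc]
  rw [hm']
  ring

end TwoFree

end Summit.CriticalPhenomena.PercolationContinuityZ3.Theorems
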